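import Summits.HodgeConjecture.HodgeConjecture.Theorems.MarkmanPartnerTransportRealQuadraticFunnel
import Summits.HodgeConjecture.HodgeConjecture.Theorems.MarkmanPartnerTransportPicardThreeK3SquaresRealMultiplicationTypeExact
import Summits.HodgeConjecture.HodgeConjecture.Theorems.MarkmanPartnerTransportRankPartneredHK

/-!
# Route MarkmanPartnerTransport · cruxes #4 ∕ #5 — «REAL-QUADRATIC FUNNEL», corollaries: every real-quadratic case of both
# cruxes from `CellHC[1, 2]` (the orphan cell), modulo the displayed Noether–Lefschetz families and named facts

Sequel to `…RealQuadraticFunnel` (`hodgeConjectureFor_square_of_nlDescentX_hilbertSquare`: HC⁴(`S ⊗ S`) for a non-CM,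
non-scalar K3 surface from `CellHC[1, 2]` and the displayed absorption families of its Hilbert squares). Plugged into the
K3-side quadratic ascent (`NLAscent.hodgeConjectureFor_square_of_quadratic_nlAscent`, `RealMultiplicationType.hodgeConjectureFor_square_of_rank_mem`)
and the fourfold-side partner theorem (`hodgeConjectureFor_of_rank_mem_K3Sq2Type`):

* `hCell_of_cellHC_one_two` — the K3-form input `hCell` of `…NLAscentQuadratic` (HC⁴ for the non-CM quadratic-RM K3 squares of
  Picard number `2`) ⟸ `CellHC[1, 2]` + `DescH` + facts;
* **`hodgeConjectureFor_square_of_quadratic_of_cellHC_one_two`** — HC⁴(`S ⊗ S`) for EVERY projective K3 surface with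
  `Quadratic[S]` and `ρ(S) ≥ 2`;
* **`hodgeConjectureFor_square_of_rank_mem_of_cellHC_one_two`** — HC⁴(`S ⊗ S`) for EVERY projective K3 surface with
  `ρ(S) ∈ {8, 12, 14, 16}`;
* **`hodgeConjectureFor_of_rank_mem_K3Sq2Type_of_cellHC_one_two`** — HC⁴(`X`) for EVERY marked smooth projective `K3^{[2]}`-type
  fourfold with `ρ(X) ∈ {9, 13, 15, 17}`;

all GRANTED: Buskin, markings, period surjectivity (last item), the displayed K3-side quadratic ascent families
(`…NLAscentQuadratic`, (I1′)), the displayed X-side absorption families of the Hilbert squares of the Picard-number-2 quadratic K3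
surfaces (`DescH`, (I1′-X)), **`CellHC[1, 2]`**, and the named facts {Beauville incidence, Beauville–Fogarty blow-up (last item),
Markman lift (last item), Markman isometry-algebraic, O'Grady, Voisin cup, Verbitsky–Guan, Charles–Markman}. No definition, no sorry,
no new named fact; credits nothing to HC (cell `(1,2)` — the very general polarised `K3^{[2]}`-type fourfold with `ρ = 1` and real
quadratic multiplication — is OPEN). Prover seat hodge-nonav-19652-p1 (gen 19), `--supports stmt-HodgeConjecture-19652`.

References: B. van Geemen, M. Schütt, Forum Math. Sigma 13 (2025) e2 §2.6, Prop. 3.2, §3.4, §6.6; N. Buskin, J. reine angew. Math.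
755 (2019) Thm. 1.1; E. Markman, Compos. Math. 160 (2024) Thm. 1.1, 1.4; A. Beauville, J. Differential Geom. 18 (1983) §6;
F. Charles, E. Markman, Compos. Math. 149 (2013) Thm. 1.1; C. Voisin, *Hodge Theory II* Thm. 4.18, §7.3.2.
-/

noncomputable section

set_option linter.dupNamespace false

open Module CategoryTheory MonoidalCategory CartesianMonoidalCategory AlgebraicGeometry Polynomial
open Literature.AlgebraicTopology.SingularHomology Literature.Geometry.Kaehler
open Literature.AlgebraicGeometry Literature.AlgebraicGeometry.Motives Literature.AlgebraicGeometry.HodgeTheory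
open Literature.AlgebraicGeometry.Hyperkaehler Literature.AlgebraicGeometry.Surfaces
open Literature.AlgebraicGeometry.HilbertScheme
open Summit.HodgeConjecture.HodgeConjecture.Theorems.NikulinTwinTransport
open Summit.HodgeConjecture.HodgeConjecture.Theorems.MarkmanPartnerTransport.BBFPositivity

namespace Summit.HodgeConjecture.HodgeConjecture.Theorems.MarkmanPartnerTransport.PartnerLattice

/-- `MarkedK3Sq[X, φ, P, z]`: VERBATIM the route binder. Local notation only. -/
local notation3 (prettyPrint := false) "MarkedK3Sq[" X ", " φ ", " P ", " z "]" =>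
  (((IsIntegralClass P ∧ ∀ Q : complexBetti X (2 * 4), IsIntegralClass Q → ∃ n : ℤ, Q = n • P) ∧
    (∀ c : complexBetti X 2, IsIntegralClass c ↔ ∃ v : K3HilbertIndex → ℤ, φ c = fun i => (v i : ℂ)) ∧
    (∀ a : complexBetti X 2, cupPowTwo a 4 = ((3 : ℂ) * (k3HilbertForm 2 (φ a) (φ a)) ^ 2) • P) ∧
    (IsOfHodgeType 4 X 2 2 0 (LinearEquiv.symm φ z) ∧
      ∀ τ : complexBetti X 2, IsOfHodgeType 4 X 2 2 0 τ → ∃ t : ℂ, τ = t • LinearEquiv.symm φ z) ∧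
    (∀ c : complexBetti X 2, IsOfHodgeType 4 X 2 1 1 c ↔
      (k3HilbertForm 2 (φ c) z = 0 ∧ k3HilbertForm 2 (φ c) (star z) = 0)) ∧
    (k3HilbertForm 2 z z = 0 ∧ 0 < (k3HilbertForm 2 (star z) z).re)))

/-- `MarkedK3[S, η, p, x]`: VERBATIM the route binder. Local notation only. -/
local notation3 (prettyPrint := false) "MarkedK3[" S ", " η ", " p ", " x "]" =>
  (p ≠ 0 ∧ (IsIntegralClass p ∧
    (∀ q : complexBetti S (2 * 2), IsIntegralClass q → ∃ n : ℤ, q = n • p) ∧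
    (∀ c : complexBetti S (2 * 1), IsIntegralClass c ↔ ∃ v : K3Index → ℤ, η c = fun i => (v i : ℂ)) ∧
    (∀ a b : complexBetti S (2 * 1),
      cupProduct (rfl : 2 * 1 + 2 * 1 = 2 * 2) a b = k3Form (η a) (η b) • p) ∧
    IsOfHodgeType 2 S (2 * 1) 2 0 (LinearEquiv.symm η x) ∧
    (∀ τ : complexBetti S (2 * 1), IsOfHodgeType 2 S (2 * 1) 2 0 τ →
      ∃ t : ℂ, τ = t • LinearEquiv.symm η x)) ∧
    (k3Form x x = 0 ∧ 0 < (k3Form (star x) x).re ∧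
      ∃ u : K3Index → ℤ, k3Form (fun i => (u i : ℂ)) x = 0 ∧ 0 < ∑ i, ∑ j, u i * k3Gram i j * u j))

/-- `SpIso[X, φ]`: VERBATIM the route binder. Local notation only. -/
local notation3 (prettyPrint := false) "SpIso[" X ", " φ "]" =>
  (∀ f : complexBetti X 2 →ₗ[ℂ] complexBetti X 2, (∀ y, IsRationalClass y → IsRationalClass (f y)) →
    (∀ (i j : ℕ) y, IsOfHodgeType 4 X 2 i j y → IsOfHodgeType 4 X 2 i j (f y)) →
    (∀ d : complexBetti X 2, d ∈ algebraicClasses X 1 → f d = 0) →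
    (∀ y : complexBetti X 2, ∀ d : complexBetti X 2, d ∈ algebraicClasses X 1 →
      k3HilbertForm 2 (φ (f y)) (φ d) = 0) →
    ∃ (k : ℕ) (c : Fin k → ℚ) (g : Fin k → (complexBetti X 2 →ₗ[ℂ] complexBetti X 2)),
      (∀ i, Function.Bijective (g i) ∧ (∀ y, IsRationalClass y → IsRationalClass (g i y)) ∧
        (∀ (a b : ℕ) y, IsOfHodgeType 4 X 2 a b y → IsOfHodgeType 4 X 2 a b (g i y)) ∧
        (∀ a b, k3HilbertForm 2 (φ (g i a)) (φ (g i b)) = k3HilbertForm 2 (φ a) (φ b))) ∧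
      ∀ y : complexBetti X 2, (∀ d : complexBetti X 2, d ∈ algebraicClasses X 1 →
        k3HilbertForm 2 (φ y) (φ d) = 0) → f y = ∑ i : Fin k, ((c i : ℂ) • g i y))

/-- `RMgenWith[X, φ, z, d, θ]`: VERBATIM `…LowPicardRMNLDescentX`. Local notation only. -/
local notation3 (prettyPrint := false) "RMgenWith[" X ", " φ ", " z ", " d ", " θ "]" =>
  ((∀ y, IsRationalClass y → IsRationalClass (θ y)) ∧
    (∀ (i j : ℕ) y, IsOfHodgeType 4 X 2 i j y → IsOfHodgeType 4 X 2 i j (θ y)) ∧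
    (∀ y w : complexBetti X 2, k3HilbertForm 2 (φ (θ y)) (φ w) = k3HilbertForm 2 (φ y) (φ (θ w))) ∧
    ∃ ev : ℂ, θ (LinearEquiv.symm φ z) = ev • LinearEquiv.symm φ z ∧ ev.im = 0 ∧
      (minpoly ℚ ev).natDegree = d ∧
      (∃ n : ℕ, 3 ≤ n ∧ d * n + Module.finrank ℂ ↥(algebraicClasses X 1) = 23) ∧
      ∀ f : complexBetti X 2 →ₗ[ℂ] complexBetti X 2, (∀ y, IsRationalClass y → IsRationalClass (f y)) →
        (∀ (i j : ℕ) y, IsOfHodgeType 4 X 2 i j y → IsOfHodgeType 4 X 2 i j (f y)) →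
        ∃ c : Fin d → ℚ, ∀ y : complexBetti X 2,
          (∀ a : complexBetti X 2, a ∈ algebraicClasses X 1 → k3HilbertForm 2 (φ y) (φ a) = 0) →
            f y = ∑ i : Fin d, ((c i : ℂ) • (θ ^ (i : ℕ)) y))

/-- `RMgen[X, φ, z, d]`: VERBATIM `…LowPicardRMCells`. Local notation only. -/
local notation3 (prettyPrint := false) "RMgen[" X ", " φ ", " z ", " d "]" =>
  (∃ θ : complexBetti X 2 →ₗ[ℂ] complexBetti X 2, RMgenWith[X, φ, z, d, θ])

/-- `CellHC[ρ, d]`: VERBATIM `…LowPicardRMCells`. Local notation only. -/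
local notation3 (prettyPrint := false) "CellHC[" ρ ", " d "]" =>
  (∀ (X : SchemeOver ℂ), IsSmoothProjective 4 X → IsOfK3HilbertSquareType X →
    ∀ (φ : complexBetti X 2 ≃ₗ[ℂ] (K3HilbertIndex → ℂ)) (P : complexBetti X (2 * 4)) (z : K3HilbertIndex → ℂ),
      MarkedK3Sq[X, φ, P, z] → ¬ SpIso[X, φ] → Module.finrank ℂ ↥(algebraicClasses X 1) = ρ →
        RMgen[X, φ, z, d] → HodgeConjectureFor 4 X)

/-- `Kap[φ, g]`: VERBATIM `…KappaClassHodge`. Local notation only. -/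
local notation3 (prettyPrint := false) "Kap[" φ ", " g "]" =>
  (∑ i : K3HilbertIndex, ∑ j : K3HilbertIndex,
    (((k3HilbertGram 2).map (Int.cast : ℤ → ℂ))⁻¹ i j) •
      cupProduct (rfl : 2 + 2 = 2 * 2) ((LinearEquiv.symm φ) (Pi.single i 1))
        (g ((LinearEquiv.symm φ) (Pi.single j 1))))

/-- `NLDescentX[X, φ, θ]`: VERBATIM `…LowPicardRMNLDescentX`. Local notation only. -/
local notation3 (prettyPrint := false) "NLDescentX[" X ", " φ ", " θ "]" =>
  (∃ w : complexBetti X (2 * 2), w ∈ algebraicClasses X 2 ∧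
    ∃ (𝒳 B : SchemeOver ℂ) (g : 𝒳 ⟶ B),
      IsSmoothProjectiveFamily g 4 ∧ IsQuasiProjectiveOver 𝒳 ∧ IsQuasiProjectiveOver B ∧
      AlgebraicGeometry.Smooth B.hom ∧ IrreducibleSpace B.left ∧
      ∃ (σ : ComplexPoints B → FiberClass g (2 * 2)) (hpt : ∀ b, (σ b).pt = b), Continuous σ ∧
      ∃ (b₁ : ComplexPoints B) (e₁ : X ≅ fiberOver g b₁),
        complexBetti.map e₁.hom (2 * 2) ((σ b₁).clsAt (hpt b₁)) = Kap[φ, θ] + w ∧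
        ∀ᶠ b in residual (ComplexPoints B),
          IsRationalClass ((σ b).clsAt (hpt b)) ∧
          IsOfHodgeType 4 (fiberOver g b) (2 * 2) 2 2 ((σ b).clsAt (hpt b)) ∧
          ∃ (X' : SchemeOver ℂ) (_ : fiberOver g b ≅ X') (_ : IsSmoothProjective 4 X') (_ : IsOfK3HilbertSquareType X')
            (φ' : complexBetti X' 2 ≃ₗ[ℂ] (K3HilbertIndex → ℂ)) (P' : complexBetti X' (2 * 4)) (z' : K3HilbertIndex → ℂ),
            MarkedK3Sq[X', φ', P', z'] ∧ ¬ SpIso[X', φ'] ∧ Module.finrank ℂ ↥(algebraicClasses X' 1) = 1 ∧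
            RMgen[X', φ', z', 2])

/-- `DescH[S]`: VERBATIM `…RealQuadraticFunnel`. Local notation only. -/
local notation3 (prettyPrint := false) "DescH[" S "]" =>
  (∀ (η : complexBetti S (2 * 1) ≃ₗ[ℂ] (K3Index → ℂ)) (p : complexBetti S (2 * 2)) (x : K3Index → ℂ), MarkedK3[S, η, p, x] →
    ∀ (H : SchemeOver ℂ) (hH : IsSmoothProjective 4 H), IsOfK3HilbertSquareType H →
    ∀ (φH : complexBetti H 2 ≃ₗ[ℂ] (K3HilbertIndex → ℂ)) (PH : complexBetti H (2 * 4)),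
      MarkedK3Sq[H, φH, PH, Sum.elim x 0] → ∀ (hS2 : IsSmoothProjective 2 S),
      ∀ θ ∈ algebraicClasses (H ⊗ S) 2,
        (∀ a : complexBetti S (2 * 1),
          φH (corrAction complexOrientationFamily hH hS2 (rfl : 2 * 1 + 2 * 2 = 2 + 2 * 2) θ a) = Sum.elim (η a) 0) →
        ∀ (d : ℕ) (θH : complexBetti H 2 →ₗ[ℂ] complexBetti H 2), RMgenWith[H, φH, Sum.elim x 0, d, θH] →
          NLDescentX[H, φH, θH])

/-- `Corr[μ, hS ; γ, y]`: `fst_*(snd^* y ∪ γ)` on `H²(S(ℂ); ℂ)`. Local notation only. -/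
local notation3 (prettyPrint := false) "Corr[" μ ", " hS " ; " γ ", " y "]" =>
  complexGysin μ (IsSmoothProjective.tensor_holds hS hS) hS
    (SemiCartesianMonoidalCategory.fst _ _) (rfl : 2 * 1 + 2 * 2 + 2 * 2 = 2 * 1 + 2 * (2 + 2))
    (cupProduct (rfl : 2 * 1 + 2 * 2 = 2 * 1 + 2 * 2)
      (complexBetti.map (SemiCartesianMonoidalCategory.snd _ _) (2 * 1) y) γ)

/-- `Quadratic[S]`: VERBATIM `…NLAscentQuadratic`. Local notation only. -/
local notation3 (prettyPrint := false) "Quadratic[" S "]" =>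
  (∃ (t : complexBetti S (2 * 1) →ₗ[ℂ] complexBetti S (2 * 1)) (P : ℚ[X]),
    (∀ y, IsRationalClass y → IsRationalClass (t y)) ∧
    (∀ (i j : ℕ) (y : complexBetti S (2 * 1)),
      IsOfHodgeType 2 S (2 * 1) i j y → IsOfHodgeType 2 S (2 * 1) i j (t y)) ∧
    (∀ d ∈ algebraicClasses S 1, t d = 0) ∧
    (∀ (y : complexBetti S (2 * 1)), ∀ d ∈ algebraicClasses S 1,
      cupProduct (rfl : 2 * 1 + 2 * 1 = 2 * 2) (t y) d = 0) ∧
    Irreducible P ∧ P.natDegree = 2 ∧ IsAnnihilatedOnTranscendentalBy S t P ∧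
    TranscendentalEndomorphismsGeneratedBy S t)

/-- `NLAscentFamily₂[S, hS]`: VERBATIM `…NLAscentQuadratic`. Local notation only. -/
local notation3 (prettyPrint := false) "NLAscentFamily₂[" S ", " hS "]" =>
  (∃ (t f : complexBetti S (2 * 1) →ₗ[ℂ] complexBetti S (2 * 1)),
    (∀ y, IsRationalClass y → IsRationalClass (t y)) ∧
    (∀ d ∈ algebraicClasses S 1, t d = 0) ∧
    TranscendentalEndomorphismsGeneratedBy S t ∧
    (∀ y, f y ∈ algebraicClasses S 1) ∧
    (∀ y : complexBetti S (2 * 1),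
      (∀ d ∈ algebraicClasses S 1, cupProduct (rfl : 2 * 1 + 2 * 1 = 2 * 2) y d = 0) → f y = 0) ∧
    ∃ (𝒳 B : SchemeOver ℂ) (g : 𝒳 ⟶ B),
      IsSmoothProjectiveFamily g 4 ∧ IsQuasiProjectiveOver 𝒳 ∧ IsQuasiProjectiveOver B ∧
      AlgebraicGeometry.Smooth B.hom ∧ IrreducibleSpace B.left ∧
      ∃ (σ : ComplexPoints B → FiberClass g (2 * 2)) (hpt : ∀ b, (σ b).pt = b), Continuous σ ∧
      ∃ (b₁ : ComplexPoints B) (e₁ : S ⊗ S ≅ fiberOver g b₁),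
        (∀ y : complexBetti S (2 * 1),
          t y + f y = Corr[complexOrientationFamily, hS ;
            complexBetti.map e₁.hom (2 * 2) ((σ b₁).clsAt (hpt b₁)), y]) ∧
        ∀ᶠ b in residual (ComplexPoints B),
          IsRationalClass ((σ b).clsAt (hpt b)) ∧
          IsOfHodgeType 4 (fiberOver g b) (2 * 2) 2 2 ((σ b).clsAt (hpt b)) ∧
          ∃ (S' : SchemeOver ℂ) (_ : IsK3Surface S') (_ : fiberOver g b ≅ S' ⊗ S'),
            Quadratic[S'] ∧
            Module.finrank ℂ ↥(algebraicClasses S' 1) + 2 = Module.finrank ℂ ↥(algebraicClasses S 1))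

variable {S X : SchemeOver ℂ} {φ : complexBetti X 2 ≃ₗ[ℂ] (K3HilbertIndex → ℂ)} {P : complexBetti X (2 * 4)}
  {z : K3HilbertIndex → ℂ}

/-- **The K3-form cell input `hCell` of `…NLAscentQuadratic` from the orphan cell**: HC⁴(`S ⊗ S`) for every non-CM projective K3
surface with `Quadratic[S]` and `ρ(S) = 2`, GRANTED `CellHC[1, 2]`, the displayed absorption families of the Hilbert squares
(`DescH`), and the named facts. (`Quadratic` ⟹ `¬ Scalar` by `RealMultiplicationType.not_scalar_of_isRealMultiplicationK3`.)
[cite: GeemenSchutt2023, §2.6, Prop. 3.2 and §3.4] [cite: Beauville1983, §6 Prop. 6] [cite: CharlesMarkman2013, Thm. 1.1] -/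
theorem hCell_of_cellHC_one_two (hBI : Beauville1983_hilbertSquare_markedIncidence)
    (hmark : Huybrechts_K3_marking_exists) (hO : OGrady2008_dualBBFClass_algebraic)
    (hcup : Voisin2003_cupProduct_algebraicClasses) (hMkI : Markman2024_rationalHodgeIsometry_algebraic_marked)
    (hV : VerbitskyGuan_cohomology_K3HilbertSquareType) (hCMk : CharlesMarkman2013_lefschetzStandard_K3HilbertType)
    (hDescAll : ∀ (S : SchemeOver ℂ), IsK3Surface S → ¬ HasComplexMultiplication S → Quadratic[S] →
      Module.finrank ℂ ↥(algebraicClasses S 1) = 2 → DescH[S])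
    (h12 : CellHC[1, 2]) :
    ∀ (S : SchemeOver ℂ) (_ : IsK3Surface S), ¬ HasComplexMultiplication S → Quadratic[S] →
      Module.finrank ℂ ↥(algebraicClasses S 1) = 2 → HodgeConjectureFor 4 (S ⊗ S) := by
  intro S hS hCM hQd hρ
  obtain ⟨t, P, ht_rat, ht_typ, ht_N, ht_perp, hPirr, hdeg, hann, hgen⟩ := id hQd
  have hQ := RealMultiplicationType.not_scalar_of_isRealMultiplicationK3 hmark
    (⟨hS, rfl, hCM, t, ht_rat, ht_typ, ht_N, ht_perp, hann, hgen⟩ :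
      IsRealMultiplicationK3 S (Module.finrank ℂ ↥(algebraicClasses S 1)) P) hPirr (by omega)
  exact hodgeConjectureFor_square_of_nlDescentX_hilbertSquare hBI hmark hO hcup hMkI hV hCMk hS hCM hQ
    (hDescAll S hS hCM hQd hρ) h12

/-- **Every K3 square with real QUADRATIC multiplication from the orphan cell**: for every projective K3 surface `S` with
`Quadratic[S]` and `ρ(S) ≥ 2`, `HodgeConjectureFor 4 (S ⊗ S)` — GRANTED Buskin, markings, the displayed K3-side quadratic ascent
families, the displayed absorption families of the Hilbert squares at `ρ(S) = 2`, `CellHC[1, 2]`, and the named facts.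
[cite: GeemenSchutt2023, §2.6, Prop. 3.2, §3.4 and §6.6] [cite: Buskin2019, Thm. 1.1] [cite: Markman2024, §1.1 Thm. 1.1] -/
theorem hodgeConjectureFor_square_of_quadratic_of_cellHC_one_two (hB : Buskin2019_hodgeIsometry_algebraic)
    (hBI : Beauville1983_hilbertSquare_markedIncidence) (hmark : Huybrechts_K3_marking_exists)
    (hO : OGrady2008_dualBBFClass_algebraic) (hcup : Voisin2003_cupProduct_algebraicClasses)
    (hMkI : Markman2024_rationalHodgeIsometry_algebraic_marked) (hV : VerbitskyGuan_cohomology_K3HilbertSquareType)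
    (hCMk : CharlesMarkman2013_lefschetzStandard_K3HilbertType)
    (hAsc : ∀ (S : SchemeOver ℂ) (hS : IsK3Surface S), ¬ HasComplexMultiplication S → Quadratic[S] →
      4 ≤ Module.finrank ℂ ↥(algebraicClasses S 1) → NLAscentFamily₂[S, hS.isSmoothProjective])
    (hDescAll : ∀ (S : SchemeOver ℂ), IsK3Surface S → ¬ HasComplexMultiplication S → Quadratic[S] →
      Module.finrank ℂ ↥(algebraicClasses S 1) = 2 → DescH[S])
    (h12 : CellHC[1, 2]) (hS : IsK3Surface S) (hQd : Quadratic[S]) (h2 : 2 ≤ Module.finrank ℂ ↥(algebraicClasses S 1)) :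
    HodgeConjectureFor 4 (S ⊗ S) :=
  NLAscent.hodgeConjectureFor_square_of_quadratic_nlAscent hB hmark hAsc
    (hCell_of_cellHC_one_two hBI hmark hO hcup hMkI hV hCMk hDescAll h12) _ S hS hQd rfl h2

/-- **Every K3 square of Picard number `8, 12, 14, 16` from the orphan cell** (real quadratic multiplication is forced there:
`RealMultiplicationType.hodgeConjectureFor_square_of_rank_mem`), GRANTED the same inputs.
[cite: GeemenSchutt2023, §2.1, §2.6 and §3.4] [cite: Buskin2019, Thm. 1.1] [cite: Vangeemen2008, Lemma 3.2] -/
theorem hodgeConjectureFor_square_of_rank_mem_of_cellHC_one_two (hB : Buskin2019_hodgeIsometry_algebraic)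
    (hBI : Beauville1983_hilbertSquare_markedIncidence) (hmark : Huybrechts_K3_marking_exists)
    (hO : OGrady2008_dualBBFClass_algebraic) (hcup : Voisin2003_cupProduct_algebraicClasses)
    (hMkI : Markman2024_rationalHodgeIsometry_algebraic_marked) (hV : VerbitskyGuan_cohomology_K3HilbertSquareType)
    (hCMk : CharlesMarkman2013_lefschetzStandard_K3HilbertType)
    (hAsc : ∀ (S : SchemeOver ℂ) (hS : IsK3Surface S), ¬ HasComplexMultiplication S → Quadratic[S] →
      4 ≤ Module.finrank ℂ ↥(algebraicClasses S 1) → NLAscentFamily₂[S, hS.isSmoothProjective])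
    (hDescAll : ∀ (S : SchemeOver ℂ), IsK3Surface S → ¬ HasComplexMultiplication S → Quadratic[S] →
      Module.finrank ℂ ↥(algebraicClasses S 1) = 2 → DescH[S])
    (h12 : CellHC[1, 2]) (hS : IsK3Surface S)
    (hρ : Module.finrank ℂ ↥(algebraicClasses S 1) = 8 ∨ Module.finrank ℂ ↥(algebraicClasses S 1) = 12 ∨
      Module.finrank ℂ ↥(algebraicClasses S 1) = 14 ∨ Module.finrank ℂ ↥(algebraicClasses S 1) = 16) :
    HodgeConjectureFor 4 (S ⊗ S) :=
  RealMultiplicationType.hodgeConjectureFor_square_of_rank_mem hB hmark hAsc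
    (hCell_of_cellHC_one_two hBI hmark hO hcup hMkI hV hCMk hDescAll h12) hS hρ

/-- **Every marked `K3^{[2]}`-type fourfold of Picard number `9, 13, 15, 17` from the orphan cell** (its K3 partner has
`ρ(S) ∈ {8,12,14,16}`; `hodgeConjectureFor_of_rank_mem_K3Sq2Type`), GRANTED the same inputs + period surjectivity, Beauville–Fogarty
and Markman's lift. [cite: Markman2024, Thm. 1.1 and 1.4] [cite: Huybrechts2016K3, Ch. 6 Thm. 3.1 and Ch. 7 Thm. 4.1]
[cite: GeemenSchutt2023, §2.6, Prop. 3.2 and §3.4] -/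
theorem hodgeConjectureFor_of_rank_mem_K3Sq2Type_of_cellHC_one_two (hPS : Huybrechts_K3_periodSurjective_projective)
    (hBI : Beauville1983_hilbertSquare_markedIncidence) (hBD : Beauville1983_hilbertSquare_blowupDiagonal_surjection)
    (hMk : Markman2024_rationalHodgeIsometry_lift_algebraic_marked) (hcup : Voisin2003_cupProduct_algebraicClasses)
    (hB : Buskin2019_hodgeIsometry_algebraic) (hmark : Huybrechts_K3_marking_exists) (hO : OGrady2008_dualBBFClass_algebraic)
    (hMkI : Markman2024_rationalHodgeIsometry_algebraic_marked) (hV : VerbitskyGuan_cohomology_K3HilbertSquareType)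
    (hCMk : CharlesMarkman2013_lefschetzStandard_K3HilbertType)
    (hAsc : ∀ (S : SchemeOver ℂ) (hS : IsK3Surface S), ¬ HasComplexMultiplication S → Quadratic[S] →
      4 ≤ Module.finrank ℂ ↥(algebraicClasses S 1) → NLAscentFamily₂[S, hS.isSmoothProjective])
    (hDescAll : ∀ (S : SchemeOver ℂ), IsK3Surface S → ¬ HasComplexMultiplication S → Quadratic[S] →
      Module.finrank ℂ ↥(algebraicClasses S 1) = 2 → DescH[S])
    (h12 : CellHC[1, 2]) (hX : IsSmoothProjective 4 X) (hK : IsOfK3HilbertSquareType X) (hM : MarkedK3Sq[X, φ, P, z])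
    (hρ : Module.finrank ℂ ↥(algebraicClasses X 1) = 9 ∨ Module.finrank ℂ ↥(algebraicClasses X 1) = 13 ∨
      Module.finrank ℂ ↥(algebraicClasses X 1) = 15 ∨ Module.finrank ℂ ↥(algebraicClasses X 1) = 17) :
    HodgeConjectureFor 4 X :=
  hodgeConjectureFor_of_rank_mem_K3Sq2Type hPS hBI hBD hMk hcup hB hmark hAsc
    (hCell_of_cellHC_one_two hBI hmark hO hcup hMkI hV hCMk hDescAll h12) hX hK hM hρ

end Summit.HodgeConjecture.HodgeConjecture.Theorems.MarkmanPartnerTransport.PartnerLattice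

end
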